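import Summits.CriticalPhenomena.CardyFormulaZ2.Theorems.CardyMagicRigidityNestingRigidityNeckZ2StrandsBarrier
import HarnessLib

/-!
# Crux `NestingRigidity`, line `pinch-resampling` (v4), stub S12: `ZFourStrandsPositive` (III) — exactly two, or a disjoint stray

Crux `Summit.CriticalPhenomena.CardyFormulaZ2.Theses.CardyMagicRigidity.NestingRigidity` (stmt-CriticalPhenomena-4835),
line `pinch-resampling` v4, stub S12, input `ZFourStrandsPositive`; sequel of `…NeckZ2StrandsBarrier` (strategy in
`…NeckZ2StrandsWitnesses`).

This file: §8a the two stray events ("some primal / dual crossing of the collar exists"); §8 the deterministic core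
(registered anchor `zFourStrands_of_witness`): on lattice configurations,
`strandsWitness s ∖ (strandsWitness s □ (primalStray s ∪ dualStray s)) ⊆ ZFourStrands 0 s` — the four feet are crossings
in distinct clusters; if one of the two `TwoCrossingClusters` clauses fails, a THIRD crossing (dual crossing) joined to
neither foot exists, and its open edges (crossed closed edges) are disjoint from those of the four witnesses: two disjoint
cylinders; §9 locality of the three events.
-/

noncomputable section

namespace Summit.CriticalPhenomena.CardyFormulaZ2.Cruxes.NestingRigidity.PinchResampling

open MeasureTheory Set Literature.Probability.Percolation Literature.Probability.LatticeModels SimpleGraph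
open ZPinchLocality NeckCoarseZ2

namespace ZStrands

variable {ω : BondConfig (Site 2)} {s : ℕ}

/-! ## §8a The two stray events -/

/-- **Primal stray**: some primal-open crossing of the collar `Λ_{2s} ∖ Λ_s` exists. -/
def primalStray (s : ℕ) : Set (BondConfig (Site 2)) :=
  {ω | ∃ v, IsCrossing (zdGraph 2) (openGraph ω) (zBall 0 s) (zBall 0 (2 * s)) v}

/-- **Dual stray**: some dual-open crossing of the dual collar exists. -/
def dualStray (s : ℕ) : Set (BondConfig (Site 2)) :=
  {ω | ∃ v, IsCrossing (zdGraph 2) (openGraph (dualConfig ω)) (zDualBall 0 s) (zDualBall 0 (2 * s)) v}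

/-! ## §8 A third crossing cluster misses the witnesses: reduction to disjoint occurrence -/

/-- Among three pairwise non-joined crossings, one is joined to neither of two given vertices. -/
theorem exists_third {α : Type*} {P : α → α → Prop} (hsymm : ∀ a b, P a b → P b a)
    (htrans : ∀ a b c, P a b → P b c → P a c) {C : α → Prop} {e w v₁ v₂ v₃ : α}
    (h₁ : C v₁) (h₂ : C v₂) (h₃ : C v₃) (h12 : ¬ P v₁ v₂) (h13 : ¬ P v₁ v₃) (h23 : ¬ P v₂ v₃) :
    ∃ v, C v ∧ ¬ P v e ∧ ¬ P v w := by
  by_cases a1 : P v₁ e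
  · by_cases b2 : P v₂ w
    · exact ⟨v₃, h₃, fun h ↦ h13 (htrans _ _ _ a1 (hsymm _ _ h)), fun h ↦ h23 (htrans _ _ _ b2 (hsymm _ _ h))⟩
    · exact ⟨v₂, h₂, fun h ↦ h12 (htrans _ _ _ a1 (hsymm _ _ h)), b2⟩
  · by_cases a2 : P v₁ w
    · by_cases b1 : P v₂ e
      · exact ⟨v₃, h₃, fun h ↦ h23 (htrans _ _ _ b1 (hsymm _ _ h)), fun h ↦ h13 (htrans _ _ _ a2 (hsymm _ _ h))⟩
      · exact ⟨v₂, h₂, b1, fun h ↦ h12 (htrans _ _ _ a2 (hsymm _ _ h))⟩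
    · exact ⟨v₁, h₁, a1, a2⟩

/-- **`strandsWitness ∖ (strandsWitness □ stray) ⊆ ZFourStrands` at the origin** (lattice configurations, `s ≥ 8`;
registered helper, anchor of this module on the crux item).  The witnesses give two primal and two dual crossings in
distinct crossing clusters (`strands_primal_feet_not_joined`, `strands_dual_feet_not_joined`); if one of the two
`TwoCrossingClusters` clauses of `ZFourStrands 0 s` fails, there is a THIRD crossing (dual crossing) joined to
neither foot, whose open edges (crossed closed edges) are disjoint from the open edges and crossed closed edges of
the four witnesses — a pair of disjoint cylinders realising `strandsWitness s` and `primalStray s ∪ dualStray s`. -/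
theorem zFourStrands_of_witness : ∀ (ω : BondConfig (Site 2)) (s : ℕ), 8 ≤ s → ω ⊆ (zdGraph 2).edgeSet → ω ∈ strandsWitness s → ω ∉ disjointOccurrence (strandsWitness s) (primalStray s ∪ dualStray s) → ω ∈ ZFourStrands 0 s := by
  intro ω s hs hω hW hnd
  have hs1 : 1 ≤ s := by omega
  have hhq : (hq s : ℤ) ≤ s := by unfold hq; omega
  have hwq : (wq s : ℤ) + 1 ≤ s := by unfold wq; omega
  obtain ⟨e, p, R, he0, hp0, hR, hRd, hRo, hpe⟩ := strands_exists_east ω s hs1 hW.1.1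
  obtain ⟨w, p', R', hw0, hp'0, hR', hR'o, hp'e⟩ := exists_west hs1 hW.1.2
  obtain ⟨a₁, f₁, U₁, ha₁, hf₁, hU₁, hU₁c, hf₁c⟩ := exists_top hs1 hW.2.1
  obtain ⟨a₂, f₂, U₂, ha₂, hf₂, hU₂, hU₂c, hf₂c⟩ := exists_bot hs1 hW.2.2
  set A := zBall 0 (2 * s) \ zBall 0 s with hA
  set D := zDualBall 0 (2 * s) \ zDualBall 0 s with hD
  -- supports of the witnesses inside the collars
  have hRA : ∀ z ∈ R.support, z ∈ A := fun z hz ↦ by have := hR z hz; simp only [hA, mem_collar_iff, abs_le]; omega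
  have hR'A : ∀ z ∈ R'.support, z ∈ A := fun z hz ↦ by have := hR' z hz; simp only [hA, mem_collar_iff, abs_le]; omega
  have hU₁D : ∀ g ∈ U₁.reverse.support, g ∈ D := fun g hg ↦ by
    rw [Walk.support_reverse, List.mem_reverse] at hg; have := hU₁ g hg; rw [hD, mem_dualCollar_iff]; omega
  have hU₂D : ∀ g ∈ U₂.reverse.support, g ∈ D := fun g hg ↦ by
    rw [Walk.support_reverse, List.mem_reverse] at hg; have := hU₂ g hg; rw [hD, mem_dualCollar_iff]; omega
  have he := hR e R.start_mem_support
  have hw := hR' w R'.start_mem_support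
  have hp := hR p R.end_mem_support
  have hp' := hR' p' R'.end_mem_support
  -- the four feet are crossings of the two collars
  have hce : IsCrossing (zdGraph 2) (openGraph ω) (zBall 0 s) (zBall 0 (2 * s)) e :=
    ⟨mem_innerLayer_east hs1 he0 (by rw [abs_le]; omega), p,
      mem_outerLayer_of_apply_zero hs1 (Or.inl hp0) (by rw [abs_le]; omega), pathIn_of_walk R hRA hRo⟩
  have hcw : IsCrossing (zdGraph 2) (openGraph ω) (zBall 0 s) (zBall 0 (2 * s)) w :=
    ⟨mem_innerLayer_west hs1 hw0 (by rw [abs_le]; omega), p',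
      mem_outerLayer_of_apply_zero hs1 (Or.inr hp'0) (by rw [abs_le]; omega), pathIn_of_walk R' hR'A hR'o⟩
  have hc₁ : IsCrossing (zdGraph 2) (openGraph (dualConfig ω)) (zDualBall 0 s) (zDualBall 0 (2 * s)) f₁ :=
    ⟨mem_innerLayer_dual_top hs1 hf₁ (by have := hU₁ f₁ U₁.end_mem_support; omega), a₁,
      mem_outerLayer_dual hs1 (Or.inl ha₁) (by have := hU₁ a₁ U₁.start_mem_support; omega),
      dualPathIn_of_faceWalk U₁.reverse hU₁D (forall_darts_reverse_sepEdge_notMem U₁ hU₁c)⟩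
  have hc₂ : IsCrossing (zdGraph 2) (openGraph (dualConfig ω)) (zDualBall 0 s) (zDualBall 0 (2 * s)) f₂ :=
    ⟨mem_innerLayer_dual_bot hs1 hf₂ (by have := hU₂ f₂ U₂.end_mem_support; omega), a₂,
      mem_outerLayer_dual hs1 (Or.inr ha₂) (by have := hU₂ a₂ U₂.start_mem_support; omega),
      dualPathIn_of_faceWalk U₂.reverse hU₂D (forall_darts_reverse_sepEdge_notMem U₂ hU₂c)⟩
  have hnj : ¬ PathIn (openGraph ω) A e w :=
    strands_primal_feet_not_joined ω s hs hω e w he0 (by omega) hw0 (by omega) a₁ f₁ U₁ ha₁ hf₁ hU₁ hU₁c hf₁c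
      a₂ f₂ U₂ ha₂ hf₂ hU₂ hU₂c hf₂c
  have hnj' : ¬ PathIn (openGraph (dualConfig ω)) D f₁ f₂ :=
    strands_dual_feet_not_joined hs R he0 hp0 hR hRd hRo hpe R' hw0 hp'0 hR' hR'o hp'e hf₁
      (hU₁ f₁ U₁.end_mem_support).1 hf₂ (hU₂ f₂ U₂.end_mem_support).1
  -- the witness pairs
  set K : Set (Sym2 (Site 2)) := {ε | ε ∈ R.edges ∨ ε = s(p, p + Pi.single 0 1) ∨ ε ∈ R'.edges ∨
    ε = s(p', p' - Pi.single 0 1)} ∪ {ε | (∃ d ∈ U₁.darts, ε = sepEdge d.fst d.snd) ∨ ε = sepEdge f₁ (f₁ - Pi.single 1 1) ∨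
    (∃ d ∈ U₂.darts, ε = sepEdge d.fst d.snd) ∨ ε = sepEdge f₂ (f₂ + Pi.single 1 1)} with hK
  have cylK : localCylinder K ω ⊆ strandsWitness s := by
    intro ω' hω'
    have hop : ∀ ε, ε ∈ R.edges ∨ ε = s(p, p + Pi.single 0 1) ∨ ε ∈ R'.edges ∨ ε = s(p', p' - Pi.single 0 1) →
        ε ∈ ω' := fun ε h ↦ (hω' ε (Or.inl h)).2 (by
      rcases h with h | rfl | h | rfl
      exacts [hRo _ h, hpe, hR'o _ h, hp'e])
    have hcl : ∀ ε, (∃ d ∈ U₁.darts, ε = sepEdge d.fst d.snd) ∨ ε = sepEdge f₁ (f₁ - Pi.single 1 1) ∨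
        (∃ d ∈ U₂.darts, ε = sepEdge d.fst d.snd) ∨ ε = sepEdge f₂ (f₂ + Pi.single 1 1) → ε ∉ ω' := by
      intro ε h hε
      have h1 := (hω' ε (Or.inr h)).1 hε
      rcases h with ⟨d, hd, rfl⟩ | rfl | ⟨d, hd, rfl⟩ | rfl
      exacts [hU₁c d hd h1, hf₁c h1, hU₂c d hd h1, hf₂c h1]
    have h₁ : (zdGraph 2).Adj p (p + Pi.single 0 1) := (zdGraph_adj_iff _ _).2 ⟨0, Or.inl rfl⟩
    have h₄ : (zdGraph 2).Adj p' (p' - Pi.single 0 1) := (zdGraph_adj_iff _ _).2 ⟨0, Or.inr (by simp)⟩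
    refine ⟨⟨⟨e, p + Pi.single 0 1, R.concat h₁, ?_, ?_, ?_, ?_⟩, ⟨p' - Pi.single 0 1, w, (R'.concat h₄).reverse, ?_, ?_, ?_, ?_⟩⟩,
      ⟨⟨a₁, f₁ - Pi.single 1 1, U₁.concat (adj_sub_single_one f₁), ?_, ?_, ?_, ?_⟩,
       ⟨f₂ + Pi.single 1 1, a₂, (U₂.concat ((zdGraph_adj_iff _ _).2 ⟨1, Or.inl rfl⟩ : (zdGraph 2).Adj f₂ (f₂ + Pi.single 1 1))).reverse, ?_, ?_, ?_, ?_⟩⟩⟩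
    · simpa using he0
    · simp; omega
    · intro z hz
      rw [Walk.support_concat, List.mem_append, List.mem_singleton] at hz
      simp only [Matrix.cons_val_zero, Matrix.cons_val_one]
      rcases hz with hz | rfl
      · have := hR z hz; omega
      · simp; omega
    · intro ε hε
      rw [Walk.edges_concat, List.concat_eq_append, List.mem_append, List.mem_singleton] at hε
      rcases hε with hε | rfl
      exacts [hop _ (Or.inl hε), hop _ (Or.inr (Or.inl rfl))]
    · simp; omega
    · simp; omega
    · intro z hz
      rw [Walk.support_reverse, List.mem_reverse, Walk.support_concat, List.mem_append, List.mem_singleton] at hz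
      simp only [Matrix.cons_val_zero, Matrix.cons_val_one]
      rcases hz with hz | rfl
      · have := hR' z hz; omega
      · simp; omega
    · intro ε hε
      rw [Walk.edges_reverse, List.mem_reverse, Walk.edges_concat, List.concat_eq_append, List.mem_append,
        List.mem_singleton] at hε
      rcases hε with hε | rfl
      exacts [hop _ (Or.inr (Or.inr (Or.inl hε))), hop _ (Or.inr (Or.inr (Or.inr rfl)))]
    · simp; omega
    · simp; omega
    · intro g hg
      rw [Walk.support_concat, List.mem_append, List.mem_singleton] at hg
      simp only [Matrix.cons_val_zero, Matrix.cons_val_one]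
      rcases hg with hg | rfl
      · have := hU₁ g hg; omega
      · have := hU₁ f₁ U₁.end_mem_support; simp; omega
    · intro d hd
      rw [Walk.darts_concat, List.concat_eq_append, List.mem_append, List.mem_singleton] at hd
      rcases hd with hd | rfl
      exacts [hcl _ (Or.inl ⟨d, hd, rfl⟩), hcl _ (Or.inr (Or.inl rfl))]
    · simp; omega
    · simp; omega
    · intro g hg
      rw [Walk.support_reverse, List.mem_reverse, Walk.support_concat, List.mem_append, List.mem_singleton] at hg
      simp only [Matrix.cons_val_zero, Matrix.cons_val_one]
      rcases hg with hg | rfl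
      · have := hU₂ g hg; omega
      · have := hU₂ f₂ U₂.end_mem_support; simp; omega
    · refine forall_darts_reverse_sepEdge_notMem _ fun d hd ↦ ?_
      rw [Walk.darts_concat, List.concat_eq_append, List.mem_append, List.mem_singleton] at hd
      rcases hd with hd | rfl
      exacts [hcl _ (Or.inr (Or.inr (Or.inl ⟨d, hd, rfl⟩))), hcl _ (Or.inr (Or.inr (Or.inr rfl)))]
  -- if the selection event fails, a third crossing cluster realises the stray event on pairs disjoint from `K`
  by_contra hZ
  apply hnd
  have hZ' : ¬ TwoCrossingClusters (zdGraph 2) (openGraph ω) (zBall 0 s) (zBall 0 (2 * s)) ∨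
      ¬ TwoCrossingClusters (zdGraph 2) (openGraph (dualConfig ω)) (zDualBall 0 s) (zDualBall 0 (2 * s)) :=
    not_and_or.1 hZ
  rcases hZ' with hZ' | hZ'
  · -- PRIMAL third crossing
    have h3 : ∃ v, IsCrossing (zdGraph 2) (openGraph ω) (zBall 0 s) (zBall 0 (2 * s)) v ∧
        ¬ PathIn (openGraph ω) A v e ∧ ¬ PathIn (openGraph ω) A v w := by
      unfold TwoCrossingClusters at hZ'
      push Not at hZ'
      obtain ⟨v₁, v₂, v₃, h₁, h₂, h₃, h12, h13, h23⟩ := hZ' ⟨e, w, hce, hcw, hnj⟩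
      exact exists_third (fun a b h ↦ h.symm) (fun a b c h h' ↦ h.trans h') h₁ h₂ h₃ h12 h13 h23
    obtain ⟨v, ⟨hvI, x, hx, hvx⟩, hve, hvw⟩ := h3
    obtain ⟨Q, hQA, hQo⟩ := exists_walk_of_pathIn hω hvx
    refine ⟨K, {ε | ε ∈ Q.edges}, ?_, cylK, fun ω' hω' ↦ Or.inl ⟨v, hvI, x, hx, pathIn_of_walk Q hQA fun ε hε ↦
      (hω' ε hε).2 (hQo ε hε)⟩⟩
    rw [Set.disjoint_left]
    rintro ε hεK (hεQ : ε ∈ Q.edges)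
    have hmem : ∀ y ∈ ε, y ∈ A ∧ PathIn (openGraph ω) A v y := fun y hy ↦
      ⟨hQA y (Q.mem_support_of_mem_edges hεQ hy), pathIn_takeUntil Q hQA hQo (Q.mem_support_of_mem_edges hεQ hy)⟩
    rcases hεK with (hε | rfl | hε | rfl) | hε
    · obtain ⟨d, hd, rfl⟩ := (mem_edges_iff_darts R).1 hε
      have h1 := (hmem d.fst (Sym2.mem_mk_left _ _)).2
      exact hve (h1.trans (pathIn_takeUntil R hRA hRo (R.dart_fst_mem_support_of_mem_darts hd)).symm)
    · have h1 := (hmem (p + Pi.single 0 1) (Sym2.mem_mk_right _ _)).1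
      simp only [hA, mem_collar_iff, abs_le, Pi.add_apply, single_zero_apply_zero] at h1; omega
    · obtain ⟨d, hd, rfl⟩ := (mem_edges_iff_darts R').1 hε
      have h1 := (hmem d.fst (Sym2.mem_mk_left _ _)).2
      exact hvw (h1.trans (pathIn_takeUntil R' hR'A hR'o (R'.dart_fst_mem_support_of_mem_darts hd)).symm)
    · have h1 := (hmem (p' - Pi.single 0 1) (Sym2.mem_mk_right _ _)).1
      simp only [hA, mem_collar_iff, abs_le, Pi.sub_apply, single_zero_apply_zero] at h1; omega
    · rcases hε with ⟨d, hd, rfl⟩ | rfl | ⟨d, hd, rfl⟩ | rfl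
      exacts [hU₁c d hd (hQo _ hεQ), hf₁c (hQo _ hεQ), hU₂c d hd (hQo _ hεQ), hf₂c (hQo _ hεQ)]
  · -- DUAL third crossing
    have h3 : ∃ v, IsCrossing (zdGraph 2) (openGraph (dualConfig ω)) (zDualBall 0 s) (zDualBall 0 (2 * s)) v ∧
        ¬ PathIn (openGraph (dualConfig ω)) D v f₁ ∧ ¬ PathIn (openGraph (dualConfig ω)) D v f₂ := by
      unfold TwoCrossingClusters at hZ'
      push Not at hZ'
      obtain ⟨v₁, v₂, v₃, h₁, h₂, h₃, h12, h13, h23⟩ := hZ' ⟨f₁, f₂, hc₁, hc₂, hnj'⟩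
      exact exists_third (fun a b h ↦ h.symm) (fun a b c h h' ↦ h.trans h') h₁ h₂ h₃ h12 h13 h23
    obtain ⟨v, ⟨hvI, x, hx, hvx⟩, hv₁, hv₂⟩ := h3
    obtain ⟨Q, hQD, hQc⟩ := exists_faceWalk_of_pathIn hvx
    refine ⟨K, {ε | ∃ d ∈ Q.darts, ε = sepEdge d.fst d.snd}, ?_, cylK, fun ω' hω' ↦ Or.inr ⟨v, hvI, x, hx,
      dualPathIn_of_faceWalk Q hQD fun d hd hε ↦ hQc d hd ((hω' _ ⟨d, hd, rfl⟩).1 hε)⟩⟩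
    rw [Set.disjoint_left]
    rintro ε hεK ⟨d, hd, rfl⟩
    have hcl : sepEdge d.fst d.snd ∉ ω := hQc d hd
    -- a face of `Q` is in the dual collar and dual-joined to `v`
    have hmem : ∀ y, y = d.fst ∨ y = d.snd → y ∈ D ∧ PathIn (openGraph (dualConfig ω)) D v y := by
      rintro y hy
      have hyQ : y ∈ Q.support := by
        rcases hy with rfl | rfl
        exacts [Q.dart_fst_mem_support_of_mem_darts hd, Q.dart_snd_mem_support_of_mem_darts hd]
      exact ⟨hQD y hyQ, dualPathIn_takeUntil Q hQD hQc hyQ⟩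
    -- two adjacent pairs of faces with the same separating edge are the same pair of faces
    have hfaces : ∀ {z z' : Site 2}, (zdGraph 2).Adj z z' → sepEdge z z' = sepEdge d.fst d.snd →
        (z = d.fst ∨ z = d.snd) ∧ (z' = d.fst ∨ z' = d.snd) := by
      intro z z' hzz' heq
      have h1 : s(z, z') = s(d.fst, d.snd) := by rw [← dualEdge_sepEdge hzz', ← dualEdge_sepEdge d.adj, heq]
      have hz : z ∈ s(d.fst, d.snd) := h1 ▸ Sym2.mem_mk_left _ _
      have hz' : z' ∈ s(d.fst, d.snd) := h1 ▸ Sym2.mem_mk_right _ _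
      exact ⟨Sym2.mem_iff.1 hz, Sym2.mem_iff.1 hz'⟩
    rcases hεK with hε | (⟨d₁, hd₁, hε⟩ | hε | ⟨d₂, hd₂, hε⟩ | hε)
    · rcases hε with h | h | h | h
      exacts [hcl (hRo _ h), hcl (h ▸ hpe), hcl (hR'o _ h), hcl (h ▸ hp'e)]
    · obtain ⟨h1, -⟩ := hfaces d₁.adj hε.symm
      have hP1 := (hmem _ h1).2
      have hU₁D' : ∀ g ∈ U₁.support, g ∈ D := fun g hg ↦ hU₁D g (by rwa [Walk.support_reverse, List.mem_reverse])
      have hP2 := dualPathIn_takeUntil U₁ hU₁D' hU₁c (U₁.dart_fst_mem_support_of_mem_darts hd₁)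
      have hP3 := dualPathIn_of_faceWalk U₁ hU₁D' hU₁c
      exact hv₁ (hP1.trans (hP2.symm.trans hP3))
    · obtain ⟨-, h1⟩ := hfaces (adj_sub_single_one f₁) hε.symm
      have h2 := (hmem _ h1).1
      have := hU₁ f₁ U₁.end_mem_support
      rw [hD, mem_dualCollar_iff] at h2
      simp only [Pi.sub_apply, single_one_apply_zero, single_one_apply_one, sub_zero] at h2; omega
    · obtain ⟨h1, -⟩ := hfaces d₂.adj hε.symm
      have hP1 := (hmem _ h1).2
      have hU₂D' : ∀ g ∈ U₂.support, g ∈ D := fun g hg ↦ hU₂D g (by rwa [Walk.support_reverse, List.mem_reverse])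
      have hP2 := dualPathIn_takeUntil U₂ hU₂D' hU₂c (U₂.dart_fst_mem_support_of_mem_darts hd₂)
      have hP3 := dualPathIn_of_faceWalk U₂ hU₂D' hU₂c
      exact hv₂ (hP1.trans (hP2.symm.trans hP3))
    · obtain ⟨-, h1⟩ := hfaces ((zdGraph_adj_iff _ _).2 ⟨1, Or.inl rfl⟩ : (zdGraph 2).Adj f₂ (f₂ + Pi.single 1 1)) hε.symm
      have h2 := (hmem _ h1).1
      have := hU₂ f₂ U₂.end_mem_support
      rw [hD, mem_dualCollar_iff] at h2
      simp only [Pi.add_apply, single_one_apply_zero, single_one_apply_one, add_zero] at h2; omega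

/-! ## §9 Locality of the three events -/

/-- A walk-form crossing event only reads the pairs of its rectangle. -/
theorem determinedBy_openWalkLR (u : Site 2) (M n : ℕ) (N : ℕ)
    (hN : ∀ y : Site 2, (u 0 ≤ y 0 ∧ y 0 ≤ u 0 + M ∧ u 1 ≤ y 1 ∧ y 1 ≤ u 1 + n) → y ∈ box 2 N) :
    DeterminedBy (openWalkLR u M n) ↑((box 2 N).sym2) := by
  rw [determinedBy_iff]
  have key : ∀ ω ω' : BondConfig (Site 2), ω ∩ ↑((box 2 N).sym2) = ω' ∩ ↑((box 2 N).sym2) →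
      ω ∈ openWalkLR u M n → ω' ∈ openWalkLR u M n := by
    rintro ω ω' h ⟨x, y, T, hx, hy, hTs, hTe⟩
    refine ⟨x, y, T, hx, hy, hTs, fun e he ↦ ?_⟩
    have hmem : e ∈ (↑((box 2 N).sym2) : Set (Sym2 (Site 2))) := by
      rw [Finset.mem_coe, Finset.mem_sym2_iff]
      exact fun z hz ↦ hN z (hTs z (T.mem_support_of_mem_edges he hz))
    have : e ∈ ω ∩ ↑((box 2 N).sym2) := ⟨hTe e he, hmem⟩
    rw [h] at this
    exact this.1
  exact fun ω ω' h ↦ ⟨key ω ω' h, key ω' ω h.symm⟩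

/-- **`strandsWitness s` is determined by the pairs of `B(2s+1)`.** -/
theorem determinedBy_strandsWitness (s : ℕ) : DeterminedBy (strandsWitness s) ↑((box 2 (2 * s + 2)).sym2) := by
  have hhq : hq s ≤ 2 * s + 1 := by unfold hq; omega
  have hwq : wq s ≤ s := by unfold wq; omega
  refine ((determinedBy_openWalkLR _ _ _ (2 * s + 2) fun y hy ↦ ?_).inter
    (determinedBy_openWalkLR _ _ _ (2 * s + 2) fun y hy ↦ ?_)).inter
    (((determinedBy_dualFaceCrossing _ _ _).mono fun e he ↦ ?_).inter
      ((determinedBy_dualFaceCrossing _ _ _).mono fun e he ↦ ?_))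
  · simp only [Matrix.cons_val_zero, Matrix.cons_val_one] at hy; rw [mem_box, Fin.forall_fin_two]; omega
  · simp only [Matrix.cons_val_zero, Matrix.cons_val_one] at hy; rw [mem_box, Fin.forall_fin_two]; omega
  · rw [Finset.mem_coe, Finset.mem_sym2_iff]; intro z hz
    have := apply_le_of_mem_dualFaceCrossingPairs he hz
    simp only [Matrix.cons_val_zero, Matrix.cons_val_one] at this; rw [mem_box, Fin.forall_fin_two]; omega
  · rw [Finset.mem_coe, Finset.mem_sym2_iff]; intro z hz
    have := apply_le_of_mem_dualFaceCrossingPairs he hz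
    simp only [Matrix.cons_val_zero, Matrix.cons_val_one] at this; rw [mem_box, Fin.forall_fin_two]; omega

/-- The primal stray event only reads the pairs of the collar. -/
theorem determinedBy_primalStray_gen (I O : Set (Site 2)) {K : Set (Sym2 (Site 2))} (hK : (O \ I).sym2 ⊆ K) :
    DeterminedBy {ω : BondConfig (Site 2) | ∃ v, IsCrossing (zdGraph 2) (openGraph ω) I O v} K := by
  rw [determinedBy_iff]
  intro ω ω' h
  exact exists_congr fun v ↦ ZPinchLocality.isCrossing_congr (G := zdGraph 2) (openGraph_adj_congr_of_inter_eq hK h) v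

/-- **`primalStray s` is determined by the pairs of `B(2s)`.** -/
theorem determinedBy_primalStray (s : ℕ) : DeterminedBy (primalStray s) ↑((box 2 (2 * s)).sym2) := by
  refine determinedBy_primalStray_gen _ _ fun e he ↦ ?_
  rw [Finset.mem_coe, Finset.mem_sym2_iff]
  intro z hz
  have := (mem_collar_iff.1 (Set.mem_sym2_iff_subset.1 he hz)).1
  rw [mem_box, Fin.forall_fin_two, ← abs_le, ← abs_le]; exact this

/-- **`dualStray s` is determined by a finite set of pairs** (the `dualEdge`-preimages of the pairs of the dual collar). -/
theorem exists_determinedBy_dualStray (s : ℕ) : ∃ F : Finset (Sym2 (Site 2)), DeterminedBy (dualStray s) ↑F := by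
  have hfin : (dualEdge ⁻¹' (zDualBall 0 (2 * s) \ zDualBall 0 s).sym2).Finite :=
    Set.Finite.preimage dualEdge_bijective.injective.injOn
      (finite_sym2 ((zDualBall_finite 0 _).subset fun _ h ↦ h.1))
  refine ⟨hfin.toFinset, ?_⟩
  rw [Set.Finite.coe_toFinset]
  exact DeterminedBy.preimage_dualConfig (determinedBy_primalStray_gen _ _ Subset.rfl)

/-- **The stray event is local.** -/
theorem isLocalEvent_stray (s : ℕ) : IsLocalEvent (primalStray s ∪ dualStray s) := by
  classical
  obtain ⟨F, hF⟩ := exists_determinedBy_dualStray s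
  refine ⟨(box 2 (2 * s)).sym2 ∪ F, ?_⟩
  have h1 : (↑((box 2 (2 * s)).sym2) : Set (Sym2 (Site 2))) ⊆ ↑((box 2 (2 * s)).sym2 ∪ F) := by
    rw [Finset.coe_union]; exact subset_union_left
  have h2 : (↑F : Set (Sym2 (Site 2))) ⊆ ↑((box 2 (2 * s)).sym2 ∪ F) := by
    rw [Finset.coe_union]; exact subset_union_right
  have hA := (determinedBy_iff _ _).1 ((determinedBy_primalStray s).mono h1)
  have hB := (determinedBy_iff _ _).1 (hF.mono h2)
  rw [determinedBy_iff]
  intro ω ω' h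
  simp only [mem_union, hA ω ω' h, hB ω ω' h]

/-- **The witnessed event is local.** -/
theorem isLocalEvent_strandsWitness (s : ℕ) : IsLocalEvent (strandsWitness s) :=
  ⟨_, determinedBy_strandsWitness s⟩

end ZStrands

end Summit.CriticalPhenomena.CardyFormulaZ2.Cruxes.NestingRigidity.PinchResampling

end
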